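import Mathlib
import Literature.NumberTheory.Sieve.LiouvillePolynomialValuesWeylAllCoeffs
import HarnessLib

/-!
# Teräväinen 2024, Proposition 5.4, Case 1 (major arcs): reduction to progressions

Support file (everything PROVED; no definitions, no named facts) towards the named fact
`Literature.NumberTheory.Sieve.teravainen2024_cor_2_1` (J. Teräväinen, *On the Liouville function
at polynomial arguments*, Amer. J. Math. 146 (2024) = arXiv:2010.07924, Corollary 2.1 ⊂
Theorem 2.6 for `g_j = λ`, proved in §5). In **Case 1** of the proof of Proposition 5.4 (§5.4,
p. 14) the phase polynomial is major arc: `‖q c_i‖ ≤ (log H)^{O_k(1)}/H^i` for `1 ≤ i ≤ k`.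
Writing `q c_i = a_i + θ_i` (`a_i ∈ ℤ`, `|θ_i| = ‖q c_i‖`) splits `P = c_0 + P^{(1)} + P^{(2)}`
with `P^{(1)}(t) = ∑ (a_i/q) t^i` periodic modulo `q` in `t` and `P^{(2)}(t) = ∑ (θ_i/q) t^i`
slowly varying ("partial summation to remove the `P_x^{(2)}(n)` component, and … splitting `n`
into residue classes (mod `q`)", (5.17)). This file proves the resulting deterministic inequality:
for a `1`-bounded `g` on `(0, N]` and `M₁` pieces of length `L = ⌊N/M₁⌋`,

  `|∑_{0<t≤N} g(t) e(P(t))| ≤ ∑_{j<M₁} ∑_{c<q} |∑_{jL<t≤(j+1)L, t≡c (q)} g(t)| + 2π k² K₁ N/(q M₁) + M₁`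

whenever `‖q c_i‖ ≤ K₁/N^i` (`1 ≤ i ≤ k`). (For `g(t) = λ(r t + a')` the inner sums are sums of
`λ` along progressions modulo `r q` in short intervals, handled by
`LiouvillePolynomialValuesProgressionMR.lean`.)

* `Teravainen2024.sum_Ioc_mul_eq_sum_range` — `∑_{0<t≤ML} = ∑_{j<M} ∑_{jL<t≤(j+1)L}`;
* `Teravainen2024.e_periodicPart_eq` — `e(P^{(1)}(t)) = e(P^{(1)}(t mod q))`;
* `Teravainen2024.abs_smoothPart_sub_le` — `|P^{(2)}(t) - P^{(2)}(t₀)| ≤ k² K₁ L/(q N)` for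
  `0 ≤ t₀ ≤ t ≤ N`, `t - t₀ ≤ L`;
* `Teravainen2024.norm_sum_piece_le` — the bound on one piece;
* `Teravainen2024.majorArc_norm_sum_le` — **the result** above.

## References
* J. Teräväinen, Amer. J. Math. 146 (2024), §5.4, proof of Proposition 5.4, Case 1 ((5.17)),
  arXiv:2010.07924 p. 14. [Teravainen2024]
-/

noncomputable section

open Finset Complex Polynomial

namespace Literature.NumberTheory.Sieve

namespace Teravainen2024

open Literature.NumberTheory.LFunctions Literature.NumberTheory.Sieve.Vinogradov

/-! ### Pieces of `(0, N]` -/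

/-- `∑_{0<t≤ML} f(t) = ∑_{j<M} ∑_{jL<t≤(j+1)L} f(t)`. [folklore] -/
theorem sum_Ioc_mul_eq_sum_range {α : Type*} [AddCommMonoid α] (f : ℕ → α) (M L : ℕ) :
    ∑ t ∈ Finset.Ioc 0 (M * L), f t =
      ∑ j ∈ Finset.range M, ∑ t ∈ Finset.Ioc (j * L) ((j + 1) * L), f t := by
  induction M with
  | zero => simp
  | succ M ih =>
    rw [Finset.sum_range_succ, ← ih, Finset.sum_Ioc_consecutive _ (Nat.zero_le _)
      (Nat.mul_le_mul_right L (Nat.le_succ M))]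

/-! ### The periodic part `P⁽¹⁾(t) = ∑ (a_i/q) t^i` -/

/-- **Periodicity of the rational part.** For integers `a_i` and `q ≥ 1`,
`e(∑_{i<k} (a_{i+1}/q) t^{i+1}) = e(∑_{i<k} (a_{i+1}/q) (t mod q)^{i+1})` for `t ∈ ℕ`.
[cite: Teravainen2024, §5.4 (5.17): "splitting n into residue classes (mod q)"] -/
theorem e_periodicPart_eq (a : ℕ → ℤ) {q : ℕ} (hq : 1 ≤ q) (k t : ℕ) :
    VdC.e (∑ i ∈ Finset.range k, (a (i + 1) : ℝ) / q * (t : ℝ) ^ (i + 1)) =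
      VdC.e (∑ i ∈ Finset.range k, (a (i + 1) : ℝ) / q * ((t % q : ℕ) : ℝ) ^ (i + 1)) := by
  have hqR : (q : ℝ) ≠ 0 := by exact_mod_cast (show q ≠ 0 by omega)
  -- `t^{i+1} - (t mod q)^{i+1} = q Z_i`
  have hdvd : ∀ i : ℕ, ∃ Z : ℤ, ((t : ℤ)) ^ (i + 1) - ((t % q : ℕ) : ℤ) ^ (i + 1) = q * Z := by
    intro i
    have h := sub_dvd_pow_sub_pow (t : ℤ) ((t % q : ℕ) : ℤ) (i + 1)
    have hsub : (t : ℤ) - ((t % q : ℕ) : ℤ) = q * (t / q : ℕ) := by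
      have := Nat.div_add_mod t q
      push_cast
      have h' : ((q * (t / q) + t % q : ℕ) : ℤ) = (t : ℤ) := by exact_mod_cast this
      push_cast at h'
      linarith
    rw [hsub] at h
    exact (dvd_mul_right (q : ℤ) _).trans h
  choose Z hZ using hdvd
  have hdiff : ∑ i ∈ Finset.range k, (a (i + 1) : ℝ) / q * (t : ℝ) ^ (i + 1) =
      ∑ i ∈ Finset.range k, (a (i + 1) : ℝ) / q * ((t % q : ℕ) : ℝ) ^ (i + 1) +
        ((∑ i ∈ Finset.range k, a (i + 1) * Z i : ℤ) : ℝ) := by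
    push_cast
    rw [← Finset.sum_add_distrib]
    refine Finset.sum_congr rfl fun i _ => ?_
    have h1 : ((t : ℝ)) ^ (i + 1) - ((t % q : ℕ) : ℝ) ^ (i + 1) = q * (Z i : ℝ) := by
      have := hZ i
      exact_mod_cast this
    field_simp
    linear_combination (a (i + 1) : ℝ) * h1
  rw [hdiff, VdC.e_add_int]

/-! ### The smooth part `P⁽²⁾(t) = ∑ (θ_i/q) t^i` -/

/-- **Slow variation of the small part.** If `|θ_{i+1}| ≤ K₁/N^{i+1}` for `i < k`, `q ≥ 1`, and
`0 ≤ t₀ ≤ t ≤ N` with `t - t₀ ≤ L`, then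
`|∑_{i<k} (θ_{i+1}/q) t^{i+1} - ∑_{i<k} (θ_{i+1}/q) t₀^{i+1}| ≤ k² K₁ L/(q N)`.
[cite: Teravainen2024, §5.4 (5.17): "partial summation to remove the P⁽²⁾ component"] -/
theorem abs_smoothPart_sub_le (θ : ℕ → ℝ) {q k N : ℕ} (hq : 1 ≤ q) (hN : 1 ≤ N) {K₁ L : ℝ}
    (hK₁ : 0 ≤ K₁) (hL : 0 ≤ L) (hθ : ∀ i < k, |θ (i + 1)| ≤ K₁ / (N : ℝ) ^ (i + 1))
    {t t₀ : ℝ} (ht₀ : 0 ≤ t₀) (ht₀t : t₀ ≤ t) (htN : t ≤ N) (htt₀ : t - t₀ ≤ L) :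
    |∑ i ∈ Finset.range k, θ (i + 1) / q * t ^ (i + 1) -
        ∑ i ∈ Finset.range k, θ (i + 1) / q * t₀ ^ (i + 1)| ≤
      (k : ℝ) ^ 2 * K₁ * L / (q * N) := by
  have hqR : (1 : ℝ) ≤ q := by exact_mod_cast hq
  have hNR : (1 : ℝ) ≤ N := by exact_mod_cast hN
  have ht : 0 ≤ t := ht₀.trans ht₀t
  rw [← Finset.sum_sub_distrib]
  refine (Finset.abs_sum_le_sum_abs _ _).trans ?_
  have hterm : ∀ i ∈ Finset.range k, |θ (i + 1) / q * t ^ (i + 1) - θ (i + 1) / q * t₀ ^ (i + 1)|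
      ≤ K₁ * L * (i + 1) / (q * N) := by
    intro i hi
    rw [Finset.mem_range] at hi
    rw [← mul_sub, abs_mul, abs_div, abs_of_pos (by linarith : (0 : ℝ) < q)]
    have hpow := pow_succ_sub_pow_succ_le ht₀ ht₀t i
    have hpow0 : 0 ≤ t ^ (i + 1) - t₀ ^ (i + 1) := sub_nonneg.mpr (pow_le_pow_left₀ ht₀ ht₀t _)
    rw [abs_of_nonneg hpow0]
    have hti : t ^ i ≤ (N : ℝ) ^ i := pow_le_pow_left₀ ht htN i
    calc |θ (i + 1)| / q * (t ^ (i + 1) - t₀ ^ (i + 1))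
        ≤ (K₁ / (N : ℝ) ^ (i + 1)) / q * ((t - t₀) * (i + 1) * t ^ i) := by
          apply mul_le_mul (div_le_div_of_nonneg_right (hθ i hi) (by linarith)) hpow hpow0
          positivity
      _ ≤ (K₁ / (N : ℝ) ^ (i + 1)) / q * (L * (i + 1) * (N : ℝ) ^ i) := by
          apply mul_le_mul_of_nonneg_left _ (by positivity)
          apply mul_le_mul _ hti (by positivity) (by positivity)
          exact mul_le_mul_of_nonneg_right htt₀ (by positivity)
      _ = K₁ * L * (i + 1) / (q * N) := by
          have hN0 : (N : ℝ) ≠ 0 := by positivity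
          field_simp
          ring
  refine (Finset.sum_le_sum hterm).trans ?_
  rw [← Finset.sum_div]
  apply div_le_div_of_nonneg_right _ (by positivity)
  have hsum : ∑ i ∈ Finset.range k, K₁ * L * ((i : ℝ) + 1) = K₁ * L * ∑ i ∈ Finset.range k, ((i : ℝ) + 1) := by
    rw [Finset.mul_sum]
  rw [hsum]
  have hk : ∑ i ∈ Finset.range k, ((i : ℝ) + 1) ≤ (k : ℝ) ^ 2 := by
    have h1 : ∑ i ∈ Finset.range k, ((i : ℝ) + 1) = ∑ i ∈ Finset.range k, ((i + 1 : ℕ) : ℝ) := by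
      push_cast; rfl
    rw [h1]
    have h2 : ∑ i ∈ Finset.range k, ((i + 1 : ℕ) : ℝ) ≤ ∑ _i ∈ Finset.range k, (k : ℝ) := by
      refine Finset.sum_le_sum fun i hi => ?_
      rw [Finset.mem_range] at hi
      exact_mod_cast hi
    refine h2.trans ?_
    rw [Finset.sum_const, Finset.card_range, nsmul_eq_mul]
    nlinarith
  calc K₁ * L * ∑ i ∈ Finset.range k, ((i : ℝ) + 1) ≤ K₁ * L * (k : ℝ) ^ 2 :=
        mul_le_mul_of_nonneg_left hk (by positivity)
    _ = (k : ℝ) ^ 2 * K₁ * L := by ring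

/-! ### One piece -/

/-- Splitting a sum over a finite set of naturals into residue classes modulo `q ≥ 1`:
`‖∑_{t∈S} w(t mod q) g(t)‖ ≤ ∑_{c<q} ‖∑_{t∈S, t≡c} g(t)‖` for unimodular weights `w`. [folklore] -/
theorem norm_sum_mul_periodic_le (S : Finset ℕ) {q : ℕ} (hq : 1 ≤ q) (w : ℕ → ℂ)
    (hw : ∀ c, ‖w c‖ ≤ 1) (g : ℕ → ℂ) :
    ‖∑ t ∈ S, w (t % q) * g t‖ ≤ ∑ c ∈ Finset.range q, ‖∑ t ∈ S.filter (fun t => t % q = c), g t‖ := by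
  classical
  rw [← Finset.sum_fiberwise_of_maps_to (s := S) (t := Finset.range q) (g := fun t => t % q)
    (fun t _ => Finset.mem_range.mpr (Nat.mod_lt t (by omega)))]
  refine (norm_sum_le _ _).trans (Finset.sum_le_sum fun c _ => ?_)
  have h1 : ∑ t ∈ S.filter (fun t => t % q = c), w (t % q) * g t =
      w c * ∑ t ∈ S.filter (fun t => t % q = c), g t := by
    rw [Finset.mul_sum]
    refine Finset.sum_congr rfl fun t ht => ?_
    rw [(Finset.mem_filter.mp ht).2]
  rw [h1, norm_mul]
  calc ‖w c‖ * ‖∑ t ∈ S.filter (fun t => t % q = c), g t‖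
      ≤ 1 * ‖∑ t ∈ S.filter (fun t => t % q = c), g t‖ :=
        mul_le_mul_of_nonneg_right (hw c) (norm_nonneg _)
    _ = _ := one_mul _

/-- **One piece.** With `q c_{i+1} = a_{i+1} + θ_{i+1}`, `|θ_{i+1}| ≤ K₁/N^{i+1}` (`i < k`), a
`1`-bounded `g`, and a piece `(t₀, t₀ + L'] ⊆ (0, N]` with `L' ≤ L`:
`‖∑_{t₀<t≤t₀+L'} g(t) e(c₀ + ∑ c_{i+1} t^{i+1})‖ ≤ ∑_{c<q} ‖∑_{t₀<t≤t₀+L', t≡c (q)} g(t)‖ + L' · 2π k²K₁L/(qN)`.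
[cite: Teravainen2024, §5.4 (5.17)] -/
theorem norm_sum_piece_le {q k N : ℕ} (hq : 1 ≤ q) (hN : 1 ≤ N) (a : ℕ → ℤ) (θ : ℕ → ℝ)
    {K₁ : ℝ} (hK₁ : 0 ≤ K₁) (hθ : ∀ i < k, |θ (i + 1)| ≤ K₁ / (N : ℝ) ^ (i + 1)) (c₀ : ℝ)
    (g : ℕ → ℂ) (hg : ∀ t, ‖g t‖ ≤ 1) {t₀ L' L : ℕ} (hL' : L' ≤ L) (ht₀N : t₀ + L' ≤ N) :
    ‖∑ t ∈ Finset.Ioc t₀ (t₀ + L'), g t *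
        VdC.e (c₀ + ∑ i ∈ Finset.range k, ((a (i + 1) : ℝ) + θ (i + 1)) / q * (t : ℝ) ^ (i + 1))‖ ≤
      ∑ c ∈ Finset.range q, ‖∑ t ∈ (Finset.Ioc t₀ (t₀ + L')).filter (fun t => t % q = c), g t‖ +
        L' * (2 * Real.pi * ((k : ℝ) ^ 2 * K₁ * L / (q * N))) := by
  set P1 : ℝ → ℝ := fun x => ∑ i ∈ Finset.range k, (a (i + 1) : ℝ) / q * x ^ (i + 1) with hP1
  set P2 : ℝ → ℝ := fun x => ∑ i ∈ Finset.range k, θ (i + 1) / q * x ^ (i + 1) with hP2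
  -- split the phase
  have hphase : ∀ t : ℕ, VdC.e (c₀ + ∑ i ∈ Finset.range k,
      ((a (i + 1) : ℝ) + θ (i + 1)) / q * (t : ℝ) ^ (i + 1)) =
        VdC.e c₀ * VdC.e (P1 ((t % q : ℕ) : ℝ)) * VdC.e (P2 t) := by
    intro t
    have hsum : ∑ i ∈ Finset.range k, ((a (i + 1) : ℝ) + θ (i + 1)) / q * (t : ℝ) ^ (i + 1) =
        P1 t + P2 t := by
      simp only [hP1, hP2, ← Finset.sum_add_distrib]
      refine Finset.sum_congr rfl fun i _ => ?_
      ring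
    rw [hsum, ← add_assoc, VdC.e_add, VdC.e_add, hP1]
    simp only
    rw [e_periodicPart_eq a hq k t]
  -- main term and error term
  set S := Finset.Ioc t₀ (t₀ + L') with hS
  have hdecomp : ∑ t ∈ S, g t * VdC.e (c₀ + ∑ i ∈ Finset.range k,
      ((a (i + 1) : ℝ) + θ (i + 1)) / q * (t : ℝ) ^ (i + 1)) =
        VdC.e c₀ * VdC.e (P2 t₀) * ∑ t ∈ S, VdC.e (P1 ((t % q : ℕ) : ℝ)) * g t +
          VdC.e c₀ * ∑ t ∈ S, VdC.e (P1 ((t % q : ℕ) : ℝ)) * g t * (VdC.e (P2 t) - VdC.e (P2 t₀)) := by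
    rw [Finset.mul_sum, Finset.mul_sum, ← Finset.sum_add_distrib]
    refine Finset.sum_congr rfl fun t _ => ?_
    rw [hphase]
    ring
  rw [hdecomp]
  refine (norm_add_le _ _).trans (add_le_add ?_ ?_)
  · rw [norm_mul, norm_mul, VdC.norm_e, VdC.norm_e, one_mul, one_mul]
    exact norm_sum_mul_periodic_le S hq (fun c => VdC.e (P1 (c : ℝ))) (fun c => by
      rw [VdC.norm_e]) g
  · rw [norm_mul, VdC.norm_e, one_mul]
    refine (norm_sum_le _ _).trans ?_
    have hterm : ∀ t ∈ S, ‖VdC.e (P1 ((t % q : ℕ) : ℝ)) * g t * (VdC.e (P2 t) - VdC.e (P2 t₀))‖ ≤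
        2 * Real.pi * ((k : ℝ) ^ 2 * K₁ * L / (q * N)) := by
      intro t ht
      rw [hS, Finset.mem_Ioc] at ht
      rw [norm_mul, norm_mul, VdC.norm_e, one_mul]
      have hdiff : ‖VdC.e (P2 t) - VdC.e (P2 t₀)‖ ≤ 2 * Real.pi * ((k : ℝ) ^ 2 * K₁ * L / (q * N)) := by
        have h1 : VdC.e (P2 t) = VdC.e (P2 t₀ + (P2 t - P2 t₀)) := by rw [add_sub_cancel]
        rw [h1]
        refine (norm_e_add_sub_e_le _ _).trans (mul_le_mul_of_nonneg_left ?_ (by positivity))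
        have ht₀R : (0 : ℝ) ≤ t₀ := by positivity
        have ht₀t : (t₀ : ℝ) ≤ t := by exact_mod_cast ht.1.le
        have htN : (t : ℝ) ≤ N := by exact_mod_cast (show t ≤ N by omega)
        have htt₀ : (t : ℝ) - t₀ ≤ L := by
          have : ((t : ℕ) : ℝ) ≤ ((t₀ + L : ℕ) : ℝ) := by exact_mod_cast (show t ≤ t₀ + L by omega)
          push_cast at this; linarith
        have := abs_smoothPart_sub_le θ hq hN hK₁ (by positivity : (0 : ℝ) ≤ L) hθ ht₀R ht₀t htN htt₀
        simpa only [hP2] using this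
      calc ‖g t‖ * ‖VdC.e (P2 t) - VdC.e (P2 t₀)‖ ≤ 1 * (2 * Real.pi * ((k : ℝ) ^ 2 * K₁ * L / (q * N))) :=
            mul_le_mul (hg t) hdiff (norm_nonneg _) zero_le_one
        _ = _ := one_mul _
    refine (Finset.sum_le_sum hterm).trans ?_
    rw [Finset.sum_const, nsmul_eq_mul, hS, Nat.card_Ioc, Nat.add_sub_cancel_left]

/-! ### The major-arc inequality -/

/-- **Teräväinen 2024, Proposition 5.4, Case 1: reduction to progressions.** Let `g` be
`1`-bounded, `P ∈ ℝ[X]` with `deg P ≤ k`, `q ≥ 1`, `K₁ ≥ 0`, and suppose the major-arc condition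
`‖q c_i(P)‖ ≤ K₁/N^i` for `1 ≤ i ≤ k`. Then for `1 ≤ M₁ ≤ N`, with `L = ⌊N/M₁⌋`,
`‖∑_{0<t≤N} g(t) e(P(t))‖ ≤ ∑_{j<M₁} ∑_{c<q} ‖∑_{jL<t≤(j+1)L, t≡c (q)} g(t)‖ + 2π k² K₁ N/(q M₁) + M₁`.
[cite: Teravainen2024, §5.4, proof of Proposition 5.4, Case 1 ((5.17)), for general bounded g] -/
theorem majorArc_norm_sum_le {N M₁ q k : ℕ} (hM₁ : 1 ≤ M₁) (hM₁N : M₁ ≤ N) (hq : 1 ≤ q)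
    (g : ℕ → ℂ) (hg : ∀ t, ‖g t‖ ≤ 1) (P : ℝ[X]) (hP : P.natDegree ≤ k) {K₁ : ℝ} (hK₁ : 0 ≤ K₁)
    (hmaj : ∀ i, 1 ≤ i → i ≤ k → distInt (q * P.coeff i) ≤ K₁ / (N : ℝ) ^ i) :
    ‖∑ t ∈ Finset.Ioc 0 N, g t * VdC.e (P.eval (t : ℝ))‖ ≤
      ∑ j ∈ Finset.range M₁, ∑ c ∈ Finset.range q,
          ‖∑ t ∈ (Finset.Ioc (j * (N / M₁)) ((j + 1) * (N / M₁))).filter (fun t => t % q = c), g t‖ +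
        2 * Real.pi * (k : ℝ) ^ 2 * K₁ * N / (q * M₁) + M₁ := by
  have hN : 1 ≤ N := hM₁.trans hM₁N
  have hNR : (0 : ℝ) < N := by exact_mod_cast hN
  have hqR : (0 : ℝ) < q := by exact_mod_cast hq
  have hM₁R : (0 : ℝ) < M₁ := by exact_mod_cast hM₁
  set L := N / M₁ with hLdef
  have hLM : M₁ * L ≤ N := Nat.mul_div_le N M₁
  have hrem : N - M₁ * L < M₁ := by
    have := Nat.div_add_mod N M₁; have := Nat.mod_lt N (by omega : 0 < M₁)
    rw [hLdef]; omega
  have hLR : (L : ℝ) ≤ N / M₁ := by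
    rw [le_div_iff₀ hM₁R]
    have : ((L * M₁ : ℕ) : ℝ) ≤ N := by exact_mod_cast (by rw [Nat.mul_comm]; exact hLM)
    push_cast at this; exact this
  -- integer and fractional parts of `q c_i`
  set a : ℕ → ℤ := fun i => round ((q : ℝ) * P.coeff i) with ha
  set θ : ℕ → ℝ := fun i => (q : ℝ) * P.coeff i - a i with hθdef
  have hθ : ∀ i < k, |θ (i + 1)| ≤ K₁ / (N : ℝ) ^ (i + 1) := by
    intro i hi
    have := hmaj (i + 1) (by omega) (by omega)
    unfold distInt at this
    simpa only [hθdef, ha] using this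
  -- the phase in the form of `norm_sum_piece_le`
  have heval : ∀ t : ℕ, P.eval (t : ℝ) =
      P.coeff 0 + ∑ i ∈ Finset.range k, ((a (i + 1) : ℝ) + θ (i + 1)) / q * (t : ℝ) ^ (i + 1) := by
    intro t
    rw [Polynomial.eval_eq_sum_range' (n := k + 1) (by omega), Finset.sum_range_succ']
    simp only [pow_zero, mul_one]
    rw [add_comm]
    congr 1
    refine Finset.sum_congr rfl fun i _ => ?_
    have : ((a (i + 1) : ℝ) + θ (i + 1)) / q = P.coeff (i + 1) := by
      rw [hθdef]
      simp only
      field_simp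
      ring
    rw [this]
  simp_rw [heval]
  -- split `(0, N]` into the `M₁` pieces and the remainder
  rw [← Finset.sum_Ioc_consecutive _ (Nat.zero_le (M₁ * L)) hLM, sum_Ioc_mul_eq_sum_range]
  refine (norm_add_le _ _).trans ?_
  have hpieces : ‖∑ j ∈ Finset.range M₁, ∑ t ∈ Finset.Ioc (j * L) ((j + 1) * L), g t *
      VdC.e (P.coeff 0 + ∑ i ∈ Finset.range k, ((a (i + 1) : ℝ) + θ (i + 1)) / q * (t : ℝ) ^ (i + 1))‖
      ≤ ∑ j ∈ Finset.range M₁, (∑ c ∈ Finset.range q,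
          ‖∑ t ∈ (Finset.Ioc (j * L) ((j + 1) * L)).filter (fun t => t % q = c), g t‖ +
            L * (2 * Real.pi * ((k : ℝ) ^ 2 * K₁ * L / (q * N)))) := by
    refine (norm_sum_le _ _).trans (Finset.sum_le_sum fun j hj => ?_)
    rw [Finset.mem_range] at hj
    have hjL : (j + 1) * L = j * L + L := by ring
    rw [hjL]
    refine norm_sum_piece_le hq hN a θ hK₁ hθ (P.coeff 0) g hg le_rfl ?_
    calc j * L + L = (j + 1) * L := by ring
      _ ≤ M₁ * L := Nat.mul_le_mul_right L hj
      _ ≤ N := hLM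
  have hremainder : ‖∑ t ∈ Finset.Ioc (M₁ * L) N, g t *
      VdC.e (P.coeff 0 + ∑ i ∈ Finset.range k, ((a (i + 1) : ℝ) + θ (i + 1)) / q * (t : ℝ) ^ (i + 1))‖
      ≤ M₁ := by
    refine (norm_sum_le _ _).trans ?_
    calc ∑ t ∈ Finset.Ioc (M₁ * L) N, ‖g t * VdC.e (P.coeff 0 +
          ∑ i ∈ Finset.range k, ((a (i + 1) : ℝ) + θ (i + 1)) / q * (t : ℝ) ^ (i + 1))‖
        ≤ ∑ t ∈ Finset.Ioc (M₁ * L) N, (1 : ℝ) := by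
          refine Finset.sum_le_sum fun t _ => ?_
          rw [norm_mul, VdC.norm_e, mul_one]; exact hg t
      _ = #(Finset.Ioc (M₁ * L) N) := by simp
      _ ≤ M₁ := by
          rw [Nat.card_Ioc]
          exact_mod_cast hrem.le
  refine (add_le_add hpieces hremainder).trans ?_
  rw [Finset.sum_add_distrib, Finset.sum_const, Finset.card_range, nsmul_eq_mul]
  refine add_le_add (add_le_add le_rfl ?_) le_rfl
  -- `M₁ · L · 2π k²K₁L/(qN) ≤ 2π k² K₁ N/(q M₁)`
  have hML : (M₁ : ℝ) * L ≤ N := by exact_mod_cast hLM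
  have hL0 : (0 : ℝ) ≤ L := by positivity
  calc (M₁ : ℝ) * (L * (2 * Real.pi * ((k : ℝ) ^ 2 * K₁ * L / (q * N))))
      = (2 * Real.pi * (k : ℝ) ^ 2 * K₁ / q) * ((M₁ : ℝ) * L / N) * L := by
        field_simp
    _ ≤ (2 * Real.pi * (k : ℝ) ^ 2 * K₁ / q) * 1 * (N / M₁) := by
        apply mul_le_mul _ hLR hL0 (by positivity)
        apply mul_le_mul_of_nonneg_left _ (by positivity)
        rwa [div_le_one hNR]
    _ = 2 * Real.pi * (k : ℝ) ^ 2 * K₁ * N / (q * M₁) := by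
        field_simp

end Teravainen2024

end Literature.NumberTheory.Sieve
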